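import Mathlib
import HarnessLib
import HarnessLib.Audit
import Summits.ABC.Statement
import HarnessLib.Audit.Status.Attr

/-!
Route: GlobalQuasiLogDerivative

DORMANT since 2026-08-24T11:30:56Z (reconciler: no traction for 6.7 d (last activity item-evidence-added at 2026-08-17T17:04:51Z); parked, not closed — `ledger route dormant route-ABC-GlobalQuasiLogDerivative --off` to reactivate) — unstaffed, not closed; items shared with open routes are served there. `ledger route dormant <id> --off` reactivates.

Thesis (idea card ABC/ABC/global-quasi-log-derivative). It suffices to show X =
SeparatingQuasiLogDerivativesR: for every ε > 0 there is C such that every abc triple (a, b, c) with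
a ≠ b — i.e. every abc triple except the degenerate (1, 1, 2) — is separated by a GLOBAL
ε-quasi-logarithmic derivative of size C — a function k : ℕ → ℤ (write s(n) = k(n)/rad n and D(x,y)
= rad x·k y − rad y·k x = rad x·rad y·(s y − s x)) which is
  COHERENT on every coprime pair x, y:  (x+y) ∣ rad(x+y)·D(x,y)   [⇔ e(x+y) ∣ D(x,y), e(n) = n/rad
n: the integer shadow of (a+b)·dlog(a+b) = a·dlog a + b·dlog b, asked only modulo the excess of the
sum],
  SMALL on every coprime pair x, y:     |D(x,y)| ≤ C·rad x·rad y·(x+y)^ε   [⇔ |s x − s y| ≤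
C·(x+y)^ε: the shadow of deg(a′/a − b′/b) < 0],
and has D(a,b) ≠ 0 at the triple [the shadow of a′b ≠ ab′]. X → ABC in five lines (item Bridge): c ∣
rad(c)·D(a,b), D ≠ 0 and |D| ≤ C·rad a·rad b·c^ε give c ≤ C·rad(abc)·c^ε, i.e. c^(1−ε) ≤ C·rad(abc);
the excluded triple (1,1,2) satisfies 2 < C′·2^(1+ε) for every C′ ≥ 1.
REPAIRED 2026-08-15: the first target SeparatingQuasiLogDerivatives (stmt-ABC-1689, same sentence
without the guard a ≠ b) is false at the degenerate triple (1,1,2) — IsABCTriple 1 1 2 holds and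
'rad a·k b ≠ rad b·k a' reads x ≠ x there
(Theorems.GlobalQuasiLogDerivativeSeparatingQuasiLogDerivatives_refuted, refuted-misstated; it stays
in the negatives index). Coprimality makes (1,1,2) the only abc triple with a = b, so the guard
removes exactly the witness; it is also exactly the non-degeneracy of the polynomial solutions (k n
= n²·rad n has D(a,b) = rad a·rad b·(b−a)(a+b) ≠ 0 iff a ≠ b), so X holds outright for ε ≥ 2 and its
content is ε → 0.
Lean (one line over Mathlib + Summits.ABC.ABC.Statement; radical computed in ℕ):  ∀ ε : ℝ, 0 < ε → ∃
C : ℝ, ∀ a b c : ℕ, Literature.NumberTheory.DiophantineGeometry.IsABCTriple a b c → a ≠ b → ∃ k : ℕ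
→ ℤ, (∀ x y : ℕ, 0 < x → 0 < y → Nat.Coprime x y → ((x + y : ℕ) : ℤ) ∣
((UniqueFactorizationMonoid.radical (x + y) : ℕ) : ℤ) * (((UniqueFactorizationMonoid.radical x : ℕ)
: ℤ) * k y - ((UniqueFactorizationMonoid.radical y : ℕ) : ℤ) * k x)) ∧ (∀ x y : ℕ, 0 < x → 0 < y →
Nat.Coprime x y → |((UniqueFactorizationMonoid.radical x : ℕ) : ℝ) * (k y : ℝ) -
((UniqueFactorizationMonoid.radical y : ℕ) : ℝ) * (k x : ℝ)| ≤ C *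
((UniqueFactorizationMonoid.radical x : ℕ) : ℝ) * ((UniqueFactorizationMonoid.radical y : ℕ) : ℝ) *
((x + y : ℕ) : ℝ) ^ ε) ∧ ((UniqueFactorizationMonoid.radical a : ℕ) : ℤ) * k b ≠
((UniqueFactorizationMonoid.radical b : ℕ) : ℤ) * k a
Imposed only AT the pair (a,b), the three conditions are equivalent to abc at that triple (Pasten's
Small-Derivatives reading, Pasten2021 Cor. 4.6); the entire content of X is that each k is coherent
and small GLOBALLY, on all coprime pairs at once, as dlog is in k[t]. Globality already bites at the
triple itself: LocalForm and the cocycle rad n·D(a,b) = rad a·D(n,b) + rad b·D(a,n) give e(c)·e(b−a)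
∣ D(a,b) for coprime a < b, so X at (a,b,c) also yields the 4-term bound c·(b−a) ≤ C·rad a·rad b·rad
c·rad(b−a)·c^ε — which is abc for the squared triple (a², b²−a², b²) at exponent 2/(2−ε) (b²−a² =
c·(b−a), c^(1−ε)·(b−a) < 2b^(2−ε)), hence still a consequence of ABC (a violating family would
refute ABC itself): any failure of X must come from the joint CRT pinning across many pairs (cruxes
Rigidity / SeparationUpgrade), never from the triple alone. ROUTE-CHOICE 2026-08-15 (after the
refutation of stmt-ABC-1689, degenerate witness only): next line = this guarded target; positive
cruxes unchanged, the negative side gains PairGluingOneTwo (rank 5: some ε glues the pair (1,2) for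
every C — the weakest statement that kills X, = ¬X at the triple (1,2,3), implied by Rigidity;
finite-level evidence at ε = 1/4: (1,2) is glued from level Z = 23, 29, 32, 46, 47, 64, 67 on for C
= 1, 3/2, 2, 3, 4, 6, 8). The card's single-function form (one k per ε separating all coprime pairs
a ≠ b) implies X; X is the exact form the bridge consumes.

Rationale: WHY THIS LINE. Mason–Stothers uses dlog only through: simple poles at primes, additivity on the one
relation a+b=c, degree drop. The card's dictionary (e(n) = n/rad n, s = k/rad) asks for an integer
object with exactly these three shadows, additivity being demanded only on coprime x+y and only
modulo e(x+y) — which is how it slips under IntegersHaveNoDerivation (audited scope: additive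
Leibniz maps). Imported area: congruence-preserving / p-adically Lipschitz function theory
(Hall–Ruzsa pseudo-polynomials: HallRR1971PseudoPolynomials, DelaygueRivoal2022,
CegielskiGrigorieffGuessarian2015). By LocalForm a coherent s is, for EVERY prime p at once, an even
p-Lipschitz function of n ∈ ℤ_p^× (one lost digit), nearly bounded in ℝ, of height ≤ C·n^(1+ε) in ℚ.
The route is an honest DICHOTOMY with two kernel-checkable exits: construct such objects (→ ABC), or
prove they are constant (→ a new catalogued barrier, informative for Pasten's programme Pasten2021:
ψ ∈ T(a,b) must then depend on the equation essentially). Planner's prior: the rigidity exit is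
likelier (counting: ≈ 4·√(2N)/log(2N) forced p-adic digits for a new value s(N) against ≈ (1+ε)·log
N + log 2C free ones), but nothing known decides it for any 0 < ε < 2, finite levels are feasible (N
≤ 24 with |s| ≤ 2, card), even polynomials show the threshold ε = 2 is real, and both exits are
cheap to state.
RANKED CRUXES. rank 2 SmallCoherentNonConstant — for every ε>0 a coherent, (ε,C)-small, NON-CONSTANT
k exists (existence horn; ε ≥ 2 is witnessed by s = n²). rank 3 Rigidity — NEGATIVE SIDE,
classically ¬(rank 2): some ε>0 forces every small coherent k to be constant; the most informative
single theorem here (route-killer + barrier 'ℤ has no global ε-quasi-logarithmic derivative'). rank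
4 SeparationUpgrade — rank 2 ⇒ the repaired target SeparatingQuasiLogDerivativesR: enough small
coherent functions to separate every abc triple with a ≠ b, with uniform C (coherent functions form
a ℤ-module L; separation is the only non-linear condition). rank 5 PairGluingOneTwo (added at the
route-choice 2026-08-15, NEGATIVE SIDE) — the WEAKEST decisive theorem of the route: some ε>0 glues
1 and 2 (k 2 = 2·k 1, i.e. s 2 = s 1) in every coherent (ε,C)-small k, for every C. It is Rigidity
specialised to the pair (1,2) (Rigidity → PairGluingOneTwo, one line) and it is exactly ¬Target at
the smallest guarded triple (1,2,3) (PairGluingOneTwo → ¬SeparatingQuasiLogDerivativesR, five lines;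
both checked in the planner's Sketch.lean), so a proof closes the target `refuted`, retires the
route at its negative exit and is the barrier 'no global ε-quasi-logarithmic derivative separates 1
from 2'; it is ranked last because it is the most tractable, not the least informative — recommended
FIRST attack for refuters/provers on the negative side (finite-level evidence under KILL CRITERIA).
Support: LocalForm (p-adic form of coherence, both horns need it), Bridge (X → ABC incl. the trivial
check of (1,1,2), formalisable now; refuter candidate proofs attached to stmt-ABC-11488). Assembly
(RESTATED 2026-08-15 at the ground repair) := SmallCoherentNonConstant → SeparationUpgrade → ABC —
the two POSITIVE cruxes alone decide the summit; it is the deciding theorem with the support Bridge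
discharged (proof: Bridge applied to hU hS : SeparatingQuasiLogDerivativesR, one line once Bridge —
candidate proof attached to stmt-ABC-11488 — has landed), and no longer the curried type of `closes`
(the previous form SmallCoherentNonConstant → SeparationUpgrade → Bridge → ABC, stmt-ABC-11489, was
pure modus ponens and failed the ground battery: ground.trivial by `tauto`). The deciding theorem
`closes (hS : SmallCoherentNonConstant) (hU : SeparationUpgrade) (hB : Bridge) : ABC := hB (hU hS)`
is unchanged; Rigidity, PairGluingOneTwo and LocalForm are deliberately not hypotheses of `closes`
(the two negative items contradict the chain's hypotheses by design — listing them would make the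
hypotheses inconsistent). Repair log 2026-08-15: target re-asked with the guard a ≠ b (new decl
SeparatingQuasiLogDerivativesR; the refuted SeparatingQuasiLogDerivatives stays a settled negative),
SeparationUpgrade / Bridge / Assembly re-pointed to it, `closes` rewritten from the 7-hypothesis
transition form to the 3-hypothesis chain; route-choice (same day): next line = the guarded target,
PairGluingOneTwo added, closes unchanged; ground repair (same day): Assembly restated as above
(Bridge internalised), no other statement, rank or hypothesis of `closes` changed.
WHAT IS LOCAL, WHAT IS GLOBAL. The bridge uses coherence/smallness/separation only AT the triple;
choosing k per triple freely would make X ⇔ ABC (a restatement). X is not that: every k must satisfy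
coherence and smallness on ALL coprime pairs; single-point modifications of a coherent k are
impossible (k(a) is pinned modulo e(a+y) for every partner y). The per-triple quantifier only
chooses WHICH global object separates the triple (needed because integer combinations x·s₁ + y·s₂ of
two solutions each lose one direction (x:y)).
KILL CRITERIA. (1) A proof of Rigidity for any ε>0 refutes SmallCoherentNonConstant: route closed
refuted, barrier filed under Literature/Barriers/ABC. (2) A coprime pair a ≠ b of some abc triple
that is glued (s a = s b) in every (ε,C)-small coherent k for EVERY C at one fixed ε refutes the
target outright (and SeparationUpgrade unless Rigidity); the canonical candidate is the pair (1,2) —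
s 2 ∈ ½ℤ is the coarsest value grid — filed as PairGluingOneTwo. By König (the gauge k 1 = 0 makes
every level finite) ¬Target at ε ⟺ for every C some guarded pair is glued at a finite level; for a
fixed pair let Z(a,b;ε,C) := least level N (all coprime pairs x<y≤N) at which every level-N solution
has s a = s b (∞ if none; monotone in N and in C), so PairGluingOneTwo at ε ⟺ Z(1,2;ε,C) < ∞ for
every C. EVIDENCE (planner route-choice 2026-08-15; exact integer arithmetic, AC-3/MAC propagation
solver cross-checked against exhaustive DFS, which reproduces the refuter's level counts on
stmt-ABC-11487 — N=16: 141275 solutions, N=20: 9333, N=23: 15069, N=24: 71457; scripts and tables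
attached to stmt-ABC-11486): at ε = 1/4, Z(1,2;C) = 23, 29, 32, 46, 47, 64, 67 for C = 1, 3/2, 2, 3,
4, 6, 8, separating witnesses at level Z−1 verified independently — the pair (1,2) re-glues after
every enlargement of C tried, at heights ≈ 23·√C, through the congruences at prime-power sums x+y ∈
{9,16,18,25,27,32,36,45,…} acting on the windows |k n| ≤ C·rad n·(n+1)^ε (propagation trace in the
evidence). Non-constant level solutions keep re-appearing much longer (C = 1: none at level 109,
again at levels ≤ 318 through n = 210), but every witness found is an isolated bump at a smooth n
(28, 30, 42, 60, 126, 210) whose admissible values are the multiples of ∏{p : p² = n+y, y ≤ N}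
inside the window (n = 210, C = 2: k ∈ 17·19ℤ from 289 and 361, killed at level 319 by 529 = 23²);
globally a bump meets infinitely many prime squares, so finite non-constancy of this kind is a
boundary artefact and says nothing for rank 2. (3) Evidence protocol for refuters (kit CP/SAT/ILP,
gauge k(1)=0, pre-cuts from LocalForm such as k(odd) even): extend C ↦ Z(1,2;ε,C) to C = 16, 32, 64
and to ε ∈ {1/2, 1}; Z finite after each doubling at heights polynomial or slower in C sends the
route to its negative exit (prove PairGluingOneTwo), a C beyond which (1,2) stays separable to the
search horizon supports rank 2/rank 4. No finite computation refutes '∃C' (level N is feasible and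
fully separating once C ≥ N², via s = n²): computations are evidence and never close an item here.
Degenerate inputs are settled: a = b only at (1,1,2) (excluded by the guard, handled inside Bridge),
and C ≤ 0 makes SMALL incompatible with separation, so the ∃C of the target is effectively over C >
0.
NOT DECOMPOSED YET (D-0019). The construction inside rank 2 (germs σ_p + archimedean gluing), the
König/compactness glue between finite levels and the infinite statement, the card's single-function
form, computational certificates — none are items until a crux closes. The import cone has no
unproved named fact: every item is over Mathlib + the audited Statement.
CHEAPEST FALSIFIER. The cheapest DECISIVE THEOREM is PairGluingOneTwo (rank 5): weaker than
Rigidity, it already closes the target `refuted`; suggested line — turn the observed finite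
mechanism into an induction on the level that is uniform in C: at small ε the windows |s x − s y| ≤
C(x+y)^ε are nearly constant while the moduli e(x+y) at prime-power sums accumulate (the header's
CRT count: ≈ e^√(2n) of pinning against ≤ 2C·n^(1+ε) admissible values), so first show that s is
pinned to s 1 on a long initial segment [1, n₀(C)] except at boundary bumps, then that s 2 ≠ s 1
contradicts the pins at the partners p²−2, 2p²±… of 2 (Hall–Ruzsa style counting,
HallRR1971PseudoPolynomials; DelaygueRivoal2022 = arXiv:2102.01534, Thm 1, for the prime-modulus
analogue). Rigidity at ONE exponent (already ε = 1, far above what the assembly needs) is the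
stronger kill and closes SmallCoherentNonConstant too — try the same counting along the prime
squares n = q², where coherence pins k(q²) to one residue class modulo M = ∏_{p < √2·q, p ≠ q}
p^(j_p) ≈ e^(√2·q) (LocalForm) while smallness leaves only ≤ 2C·q^(1+2ε) admissible values. The
cheapest COMPUTATION is the Z(1,2;ε,C) table of KILL CRITERIA (3) (minutes per cell with constraint
propagation; the level-N ILP at (ε,C) = (1,3) with the clause k(2) ≠ 2·k(1) is the same question at
one cell).

Novelty: Nearest prior art actually searched. (1) Pasten2021 (arXiv:2106.16165,
doi:10.4153/s0008439521000990): per-equation arithmetic derivatives ψ ∈ T(a,b), abc ∣ W·rad(abc)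
(Thm 3.3), abc ⇔ Small Derivatives (Cor 4.6); lit citing: 4 papers (arXiv:2307.04912,
arXiv:2402.14234, doi:10.1080/00029890.2023.2261821, arXiv:2301.03050 read p.1: Tamagawa products) —
none poses an equation-independent ψ. (2) Rigidity of congruence-preserving integer functions:
HallRR1971PseudoPolynomials (growth < (e−1)^n ⇒ polynomial), DelaygueRivoal2022 (arXiv:2102.01534,
pp.1–3 read: primary pseudo-polynomials, prime moduli only), CegielskiGrigorieffGuessarian2015
(Newton representation) — none treats congruences restricted to p-units, with one lost digit and
denominators rad n. (3) Held corpus: lit search --hybrid 'arithmetic derivative abc congruence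
radical', lit vsearch of the coherence axiom in prose, galaxy 'pseudo-polynomial' / 'congruence
preserving function': nothing on an arithmetic log-derivative coherent across equations. Delta: ONE
object s = k/rad coherent across ALL a+b=c modulo the excess e(a+b), its universal p-adic Lipschitz
structure (LocalForm), and the construct-or-rigidify dichotomy with a barrier as the negative exit;
route-level additions over the card: the division-free axiom (x+y) ∣ rad(x+y)·D(x,y), the family
form of the target (exactly what the five-line bridge consumes), LocalForm isolated as shared
support. Card graded new-combination (audit-8/triage-10).  [refs: 10.4153/s0008439521000990, 10.1080/00029890.2023.2261821, 2106.16165, 2307.04912, 2402.14234, 2301.03050, 2102.01534, doi:10.4153/s0008439521000990, doi:10.1080/00029890.2023.2261821, Pasten2021, DelaygueRivoal2022, CegielskiGrigorieffGuessarian2015]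

Barriers (technique_class: arithmetic-derivative; mason-stothers; congruence-rigidity): technique_class: arithmetic-derivative
- Literature.Barriers.ABC.IntegersHaveNoDerivation: evaded — k is neither additive nor Leibniz;
additivity of n·s(n) is asked only on coprime x+y and only modulo e(x+y) = (x+y)/rad(x+y), outside
the audited scope (IntegersHaveNoDerivationNarrow: only globally ADDITIVE substitutes are
constrained; Pasten's equation-wise ψ already sit outside). If the negative item Rigidity is proved,
this route EXTENDS the barrier from additive Leibniz maps to global ε-quasi-logarithmic derivatives,
with the p-adic mechanism made explicit.
- Literature.Barriers.ABC.EpsilonCannotBeDropped: respected — SMALL keeps the (x+y)^ε window with C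
= C(ε); at ε = 0 the target is false pointwise (it would bound c/rad(abc), which is unbounded: the
card's X(0,2) dies at (1,80,81), X(0,3) at (3,125,128)), and no polylog-loss form is claimed
(not_abc_polylog_loss is not contradicted).
- Literature.Barriers.ABC.MasonStothersFailsInCharP: not met — no function-field or characteristic-p
transfer is performed; only the three listed properties of dlog are imported into ℤ, and
non-constancy/separation (D(a,b) ≠ 0) is demanded exactly where Frobenius would kill dlog (the
analogue of 'a, b not both p-th powers').

History (route lifecycle, newest last):
- 2026-08-15T12:25:03Z · BROKEN — SeparatingQuasiLogDerivatives (stmt-ABC-1689, target) refuted by Summit.ABC.ABC.Theorems.GlobalQuasiLogDerivativeSeparatingQuasiLogDerivatives_refuted (refuter-rreview-route-NavierStokesRegula-882f29c3-0)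
- 2026-08-15T18:13:56Z · rev 3: restated SeparatingQuasiLogDerivatives (stmt-ABC-1689 refuted), SeparationUpgrade (stmt-ABC-1692), Bridge (stmt-ABC-1694), Assembly (stmt-ABC-1695) — repair: SeparatingQuasiLogDerivatives (stmt-ABC-1689, target) refuted-misstated by Theorems.GlobalQuasiLogDerivativeSeparatingQuasiLogDerivatives_refuted (degen (planner-rfix-ABC-GlobalQuasiLogDerivative-371079c1-0)
- 2026-08-15T18:13:57Z · REPAIRED (restate SeparatingQuasiLogDerivatives, SeparationUpgrade, Bridge, Assembly) — back to open: repair: SeparatingQuasiLogDerivatives (stmt-ABC-1689, target) refuted-misstated by Theorems.GlobalQuasiLogDerivativeSeparatingQuasiLogDerivatives_refuted (degen (planner-rfix-ABC-GlobalQuasiLogDerivative-371079c1-0)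
- 2026-08-15T23:38:13Z · rev 6: restated Assembly (stmt-ABC-11489) — ground repair (rground 371079c1): restate Assembly (stmt-ABC-11489 = SmallCoherentNonConstant → SeparationUpgrade → Bridge → ABC flagged ground.trivial/tauto: i (planner-rground-ABC-GlobalQuasiLogDerivative-371079c1-0)
- 2026-08-24T11:30:56Z · DORMANT — reconciler: no traction for 6.7 d (last activity item-evidence-added at 2026-08-17T17:04:51Z); parked, not closed — `ledger route dormant route-ABC-GlobalQuasiL (operator:999:2487853)

sub-problem: ABC · status: dormant · opened planner-plancard-ABC-ABC-global-quasi-log-der-fc8cd820-0 2026-08-15T10:58:08Z · rev 6 · ledger route-ABC-GlobalQuasiLogDerivative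
GENERATED by the gate from the ledger (D-0016/17). Provers cite these decls: `theorem foo : Summit.ABC.ABC.Theses.GlobalQuasiLogDerivative.<Decl> := …` in Summits/ABC/ABC/Theorems/<Name>.lean.
-/

namespace Summit.ABC.ABC.Theses.GlobalQuasiLogDerivative

open scoped BigOperators Topology Manifold Classical MeasureTheory ProbabilityTheory Matrix InnerProductSpace ComplexConjugate ContinuousMap
open Filter Set Function TopologicalSpace MeasureTheory

attribute [summit_statement] _root_.ABC

open Literature.Abc

/-- item stmt-ABC-11486 · target · rank 0 · open · by planner
why it might fail: Fails if Rigidity holds for some ε<2 (CRT count: ~e^√(2n) pinned digits vs ≤ 2C·n^(1+ε) admissible values per new value), or if small coherent k exist but each glues some coprime pair a≠b of an abc triple, or C must grow with the triple. Per guarded triple the clauses ARE abc (Pasten Thm 3.3).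
sources: Pasten2021, arXiv:2106.16165, HallRR1971PseudoPolynomials, Literature.Barriers.ABC.Pasten.abc_estimate
[target] REPAIRED target (supersedes SeparatingQuasiLogDerivatives = stmt-ABC-1689,
refuted-misstated by
Summit.ABC.ABC.Theorems.GlobalQuasiLogDerivativeSeparatingQuasiLogDerivatives_refuted: the
degenerate abc triple (1,1,2) — IsABCTriple 1 1 2 holds, Nat.Coprime 1 1 — makes the separation
clause read rad 1·k 1 ≠ rad 1·k 1; only change: the guard a ≠ b). X: for every ε>0 there is C such
that every abc triple (a,b,c) with a ≠ b (by coprimality: every abc triple except (1,1,2)) is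
separated by some GLOBAL ε-quasi-logarithmic derivative of size C — k : ℕ → ℤ (s = k/rad; D(x,y) =
rad x·k y − rad y·k x = rad x·rad y·(s y − s x)) COHERENT on every coprime pair [(x+y) ∣
rad(x+y)·D(x,y), i.e. e(x+y) ∣ D(x,y) with e(n) = n/rad n — the integer shadow of (a+b)·dlog(a+b) =
a·dlog a + b·dlog b, asked modulo the excess of the sum] and SMALL on every coprime pair [|D(x,y)| ≤
C·rad x·rad y·(x+y)^ε, i.e. |s x − s y| ≤ C·(x+y)^ε], with D(a,b) ≠ 0 at the triple. For ε ≥ 2 X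
holds outright: k n = n²·rad n is coherent and (2,1)-small with D(a,b) = rad a·rad b·(b−a)(a+b) ≠ 0
exactly when a ≠ b — the guard is the honest non-degeneracy condition, and the content is ε → 0. Per
triple the three conditions -/
@[route_item "route-ABC-GlobalQuasiLogDerivative"]
def SeparatingQuasiLogDerivativesR : Prop :=
  ∀ ε : ℝ, 0 < ε → ∃ C : ℝ, ∀ a b c : ℕ, Literature.NumberTheory.DiophantineGeometry.IsABCTriple a b c → a ≠ b → ∃ k : ℕ → ℤ, (∀ x y : ℕ, 0 < x → 0 < y → Nat.Coprime x y → ((x + y : ℕ) : ℤ) ∣ ((UniqueFactorizationMonoid.radical (x + y) : ℕ) : ℤ) * (((UniqueFactorizationMonoid.radical x : ℕ) : ℤ) * k y - ((UniqueFactorizationMonoid.radical y : ℕ) : ℤ) * k x)) ∧ (∀ x y : ℕ, 0 < x → 0 < y → Nat.Coprime x y → |((UniqueFactorizationMonoid.radical x : ℕ) : ℝ) * (k y : ℝ) - ((UniqueFactorizationMonoid.radical y : ℕ) : ℝ) * (k x : ℝ)| ≤ C * ((UniqueFactorizationMonoid.radical x : ℕ) : ℝ) * ((UniqueFactorizationMonoid.radical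 y : ℕ) : ℝ) * ((x + y : ℕ) : ℝ) ^ ε) ∧ ((UniqueFactorizationMonoid.radical a : ℕ) : ℤ) * k b ≠ ((UniqueFactorizationMonoid.radical b : ℕ) : ℤ) * k a

/-- item stmt-ABC-1690 · crux · rank 2 · open · by planner
why it might fail: Given s(1..n-1), coherence pins k(n) to ONE class mod M_n = prod_{p<sqrt(2n), p∤n} p^{j_p} ~ e^{sqrt(2n)} (LocalForm) inside an interval of length 2C·n^eps·rad n <= 2C·n^(1+eps); only algebraic conspiracies (even polynomials, growth >= 2) are known to survive; SAT evidence stops at level N=24.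
sources: HallRR1971PseudoPolynomials, DelaygueRivoal2022, arXiv:2102.01534 Thm 1(iii), Conj. 2 (pp.3-5), Pasten2021
[crux] Existence horn of the dichotomy: for every ε>0 some coherent k (coherence as in the target)
is (ε,C)-small for some C and NOT constant (s a ≠ s b for some a, b ≥ 1; gauge k ↦ k + λ·rad
preserves coherence and smallness). For ε ≥ 2 it is witnessed by s(n) = n², k = n²·rad n: D(x,y) =
rad x·rad y·(y² − x²) is divisible by x+y; even integer polynomials are the obvious coherent
functions, the non-constant ones have growth ≥ 2, so the content is ε < 2 and, for the assembly, ε →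
0. Finite levels (pairs x+y ≤ N) are feasible with |s| ≤ 2 up to N = 24 (card, exhaustive search,
e.g. k(1..24) = 0,−1,−2,−1,2,−1,4,−3,−4,−1,−10,−1,10,−1,−8,−1,−12,−1,−2,−1,−1,−1,−4,−1); by König
the (ε,C)-version holds iff every finite level is feasible, so SAT/ILP runs give evidence — never a
proof of '∃C' (level N is feasible once C ≥ N², via n²). A construction presumably goes through
LocalForm: even p-Lipschitz germs σ_p on ℤ_p^× for every p, glued into ONE s with s(n) ∈ (1/rad n)ℤ,
s(n) = σ_p(n) for p ∤ n, |s(n)| ≤ C·n^ε — a CRT gluing with archimedean size control, tight exactly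
at powerful n (rad n ≪ n). Sources: idea card; Pasten2021; HallRR1971PseudoPolynomials;
DelaygueRivoal2022. -/
@[route_item "route-ABC-GlobalQuasiLogDerivative", crux]
def SmallCoherentNonConstant : Prop :=
  ∀ ε : ℝ, 0 < ε → ∃ C : ℝ, ∃ k : ℕ → ℤ, (∀ x y : ℕ, 0 < x → 0 < y → Nat.Coprime x y → ((x + y : ℕ) : ℤ) ∣ ((UniqueFactorizationMonoid.radical (x + y) : ℕ) : ℤ) * (((UniqueFactorizationMonoid.radical x : ℕ) : ℤ) * k y - ((UniqueFactorizationMonoid.radical y : ℕ) : ℤ) * k x)) ∧ (∀ x y : ℕ, 0 < x → 0 < y → Nat.Coprime x y → |((UniqueFactorizationMonoid.radical x : ℕ) : ℝ) * (k y : ℝ) - ((UniqueFactorizationMonoid.radical y : ℕ) : ℝ) * (k x : ℝ)| ≤ C * ((UniqueFactorizationMonoid.radical x : ℕ) : ℝ) * ((UniqueFactorizationMonoid.radical y : ℕ) : ℝ) * ((x + y : ℕ) : ℝ) ^ ε) ∧ ∃ a b : ℕ, 0 < a ∧ 0 < b ∧ ((UniqueFactorizationMonoid.radical a : ℕ) :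 ℤ) * k b ≠ ((UniqueFactorizationMonoid.radical b : ℕ) : ℤ) * k a

/-- item stmt-ABC-1691 · crux · rank 3 · open · by planner
why it might fail: False for eps>=2 (s=n^2). Pairwise forcing s(a)=s(b) needs e(a+b)e(a-b) > 2C·rad a·rad b·(a+b)^eps: an abc-hit (b^2,a^2-b^2,a^2) of quality >1/(1-eps/2), finitely many under abc. A proof must use the joint CRT pinning; Hall's binomial transform dies with one lost digit (divisor ~e^sqrt(n) < 2^n).
sources: DelaygueRivoal2022, arXiv:2102.01534 Thm 1(i),(iii) p.5; Perelli-Zannier/Zannier e^0.75 p.4, HallRR1971PseudoPolynomials, Literature.Barriers.ABC.EpsilonCannotBeDropped, Pasten2021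
[crux] NEGATIVE SIDE — classically ¬SmallCoherentNonConstant; a proof closes that item `refuted`,
breaks this route by design, and should be promoted to Literature/Barriers/ABC as 'ℤ admits no
global ε-quasi-logarithmic derivative' (stronger than IntegersHaveNoDerivation; for Pasten: ψ ∈
T(a,b) must depend on the equation). Statement: some ε>0 makes every coherent k with |s x − s y| ≤
C·(x+y)^ε on coprime pairs (any C) constant. Suggested line: by LocalForm, s on p-units extends to
an even σ_p : ℤ_p^× → ℤ_p with |σ_p(u) − σ_p(v)|_p ≤ p·|u − v|_p for EVERY p at once, while s(n) ∈
(1/rad n)ℤ has height ≤ C·n^(1+ε); adapt Hall's binomial-transform argument (lcm(1..n) ∣ b_n, lcm ≈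
e^n vs |b_n| ≤ 2^n·max|a_k|) to unit-only congruences, one lost digit, denominators rad n and the ±
symmetry (e.g. interpolate s(q) at prime squares), or count forced residues of s(n) on a short
interval against the ≤ 2C·n^ε·rad n admissible values. Periodic s are already forced constant;
conjecturally every ε < 2 works. Sources: HallRR1971PseudoPolynomials (growth < (e−1)^n ⇒
polynomial); DelaygueRivoal2022; CegielskiGrigorieffGuessarian2015; Pasten2021. -/
@[route_item "route-ABC-GlobalQuasiLogDerivative"]
def Rigidity : Prop :=
  ∃ ε : ℝ, 0 < ε ∧ ∀ (C : ℝ) (k : ℕ → ℤ), (∀ x y : ℕ, 0 < x → 0 < y → Nat.Coprime x y → ((x + y : ℕ) : ℤ) ∣ ((UniqueFactorizationMonoid.radical (x + y) : ℕ) : ℤ) * (((UniqueFactorizationMonoid.radical x : ℕ) : ℤ) * k y - ((UniqueFactorizationMonoid.radical y : ℕ) : ℤ) * k x)) → (∀ x y : ℕ, 0 < x → 0 < y → Nat.Coprime x y → |((UniqueFactorizationMonoid.radical x : ℕ) : ℝ) * (k y : ℝ) - ((UniqueFactorizationMonoid.radical y : ℕ) : ℝ) * (k x : ℝ)| ≤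 C * ((UniqueFactorizationMonoid.radical x : ℕ) : ℝ) * ((UniqueFactorizationMonoid.radical y : ℕ) : ℝ) * ((x + y : ℕ) : ℝ) ^ ε) → ∀ a b : ℕ, 0 < a → 0 < b → ((UniqueFactorizationMonoid.radical a : ℕ) : ℤ) * k b = ((UniqueFactorizationMonoid.radical b : ℕ) : ℤ) * k a

-- earlier SeparationUpgrade (stmt-ABC-1692, replaced 2026-08-15T18:13:56Z -> stmt-ABC-11487): retired by None — SmallCoherentNonConstant → SeparatingQuasiLogDerivatives
/-- item stmt-ABC-11487 · crux · rank 4 · open · by planner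
why it might fail: L_ε may be thin (ℤ·k₀ + consts): k₀ may glue a coprime pair a≠b of an abc triple (s a = s b) or separate triples only with growing C; no source known of a 2nd independent element (twists n↦s(mn), point surgery break coherence: LocalForm); Pasten's Siegel-lemma independence (Lem 3.5) is per equation
sources: Pasten2021, arXiv:2106.16165, Literature.Barriers.ABC.Pasten.exists_adapted_independent
[crux] Upgrade horn (re-pointed 2026-08-15 to the repaired target; the old consequent was false at
(1,1,2), which made this item read ¬SmallCoherentNonConstant): from SOME non-constant small coherent
function for each ε to ENOUGH of them — for each abc triple with a ≠ b one separating it, with C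
uniform in the triple (exactly what Bridge consumes). Coherent functions form a ℤ-module L
(coherence linear, smallness convex, separation the only non-linear condition) containing the
constants; for fixed ε the small ones form a submodule L_ε. The item asks: once L_ε has a
non-constant element, no functional s ↦ s(a) − s(b) (a ≠ b coprime, a+b = c) vanishes on all of L_ε,
with separating witnesses of bounded size. Candidate mechanisms: (1) local surgery — modify a given
s on whole residue classes of large primes (LocalForm says which modifications stay coherent;
single-point changes never do); (2) two independent s₁, s₂ ∈ L_ε and combinations x·s₁ + y·s₂ (each
coprime pair kills one direction (x:y) — why the target quantifies one k per triple); (3) if L_ε is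
generated by explicit germs, read separation off the generators. A refutation (a coprime pair a ≠ b
glued in every small coherent k) -/
@[route_item "route-ABC-GlobalQuasiLogDerivative", crux]
def SeparationUpgrade : Prop :=
  SmallCoherentNonConstant → SeparatingQuasiLogDerivativesR

/-- item stmt-ABC-13961 · crux · rank 5 · open · by planner
why it might fail: False for ε ≥ 2 (n²·rad n); evidence is C ≤ 8 at ε = 1/4 only — a larger C might keep (1,2) separable for good; a proof must win the window-vs-moduli race uniformly in C (same mechanism as Rigidity, nothing printed does it with one lost digit and unit-only congruences).
sources: HallRR1971PseudoPolynomials, DelaygueRivoal2022, arXiv:2102.01534, Pasten2021, arXiv:2106.16165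
[crux] NEGATIVE SIDE, added at the route-choice 2026-08-15 — the weakest decisive theorem of the
route: some ε > 0 glues 1 and 2 (rad 1·k 2 = rad 2·k 1, i.e. k 2 = 2·k 1, s 2 = s 1) in EVERY
coherent (ε,C)-small k : ℕ → ℤ, for every C (coherence and smallness verbatim as in the target). It
is Rigidity specialised to the pair (1,2) (Rigidity → this, one line) and exactly
¬SeparatingQuasiLogDerivativesR at the smallest guarded abc triple (1,2,3) (this → ¬Target in five
lines; both directions compiled in the planner's Sketch.lean), so a proof closes the target
`refuted` (kill criterion (2)), sends the route to its negative exit, and is the barrier 'no global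
ε-quasi-logarithmic derivative separates 1 from 2'. False for ε ≥ 2 (k n = n²·rad n separates 1, 2
with C = 1), so any proof has small ε built in. FINITE SHADOW (planner evidence attached to
stmt-ABC-11486; ε = 1/4, level N = all coprime pairs x<y≤N, gauge k 1 = 0, exact arithmetic,
AC-3/MAC solver cross-checked by exhaustive DFS against the refuter's counts on stmt-ABC-11487): the
least level Z(C) at which every solution has k 2 = 0 is 23, 29, 32, 46, 47, 64, 67 for C = 1, 3/2,
2, 3, 4, 6, 8 (separating witnesses at Z−1 verified) -/
@[route_item "route-ABC-GlobalQuasiLogDerivative"]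
def PairGluingOneTwo : Prop :=
  ∃ ε : ℝ, 0 < ε ∧ ∀ (C : ℝ) (k : ℕ → ℤ), (∀ x y : ℕ, 0 < x → 0 < y → Nat.Coprime x y → ((x + y : ℕ) : ℤ) ∣ ((UniqueFactorizationMonoid.radical (x + y) : ℕ) : ℤ) * (((UniqueFactorizationMonoid.radical x : ℕ) : ℤ) * k y - ((UniqueFactorizationMonoid.radical y : ℕ) : ℤ) * k x)) → (∀ x y : ℕ, 0 < x → 0 < y → Nat.Coprime x y → |((UniqueFactorizationMonoid.radical x : ℕ) : ℝ) * (k y : ℝ) - ((UniqueFactorizationMonoid.radical y : ℕ) : ℝ) * (k x : ℝ)| ≤ C * ((UniqueFactorizationMonoid.radical x : ℕ) : ℝ) * ((UniqueFactorizationMonoid.radical y : ℕ) : ℝ) * ((x + y : ℕ) : ℝ) ^ ε) → ((UniqueFactorizationMonoid.radical 1 : ℕ) : ℤ) * k 2 = ((UniqueFactorizationMonoid.radical 2 : ℕ) : ℤ) * k 1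

-- earlier Bridge (stmt-ABC-1694, replaced 2026-08-15T18:13:56Z -> stmt-ABC-11488): retired by None — SeparatingQuasiLogDerivatives → ABC
/-- item stmt-ABC-11488 · support · rank 9 · open · by planner
sources: Pasten2021
[support] The five-line implication, formalisable now (≈120 lines), re-pointed 2026-08-15 to the
repaired target: given ε′ > 0 put ε = ε′/(1+ε′) and take C from the target, wlog C ≥ 1 (enlarging C
keeps SMALL); for an abc triple with a ≠ b, coherence at (a,b) gives (c:ℤ) ∣ rad(c)·D(a,b),
separation gives D ≠ 0, hence c ≤ rad(c)·|D| ≤ C·rad a·rad b·rad c·c^ε = C·rad(abc)·c^ε (radical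
multiplicative on pairwise coprime a, b, c: Mathlib `UniqueFactorizationMonoid.radical_mul` with
`Nat.Coprime.isRelPrime`; `rad a b c = radical (a*b*c)` by
`Literature.NumberTheory.DiophantineGeometry.rad_def`); so c^(1−ε) ≤ C·rad(abc) and c <
(C+1)^(1+ε′)·rad(abc)^(1+ε′) (1/(1−ε) = 1+ε′); for a = b coprimality forces a = b = 1, c = 2, rad =
2 and 2 < (C+1)^(1+ε′)·2^(1+ε′) directly; this is `ABC` via `ABC_iff`. Sources: idea card
§Mechanism; Pasten2021 Thm 3.3 / Lemma 3.4 (per-equation prototype abc ∣ W·rad(abc)). -/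
@[route_item "route-ABC-GlobalQuasiLogDerivative", crux]
def Bridge : Prop :=
  SeparatingQuasiLogDerivativesR → ABC

/-- item stmt-ABC-1693 · support · rank 9 · open · by planner
sources: CegielskiGrigorieffGuessarian2015
[support] The p-adic meaning of coherence, needed by both horns: k is coherent iff for every prime
p, every j ≥ 0 and all positive p-units a, b (coprime or not) with a ≡ −b or a ≡ b (mod p^(j+1)) one
has p^j ∣ D(a,b) = rad a·k b − rad b·k a. Equivalently s = k/rad restricted to p-units is EVEN and
Lipschitz with one lost digit, hence extends to σ_p : ℤ_p^×/±1 → ℤ_p with |σ_p(u) − σ_p(v)|_p ≤ p·|u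
− v|_p, and s(n) = σ_p(n) for every p ∤ n (card: 'forced regularity'; card triage note (1)). Proof
→: chain through a fresh c ≡ −a (mod p^(j+1)) with c ≡ 1 (mod rad(ab)) — CRT, no Dirichlet — using
the cocycle identity rad c·D(a,b) = rad a·D(c,b) + rad b·D(a,c) and p ∤ rad c; ←: for coprime a, b
and each prime p ∣ a+b (so p ∤ ab) take j = v_p(a+b) − 1, the missing p being supplied by rad(a+b),
then assemble (a+b) ∣ rad(a+b)·D prime by prime. Routine; ≈150 lines of Lean. Sources: idea card;
CegielskiGrigorieffGuessarian2015 (the congruence-preservation formalism). -/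
@[route_item "route-ABC-GlobalQuasiLogDerivative"]
def LocalForm : Prop :=
  ∀ k : ℕ → ℤ, (∀ x y : ℕ, 0 < x → 0 < y → Nat.Coprime x y → ((x + y : ℕ) : ℤ) ∣ ((UniqueFactorizationMonoid.radical (x + y) : ℕ) : ℤ) * (((UniqueFactorizationMonoid.radical x : ℕ) : ℤ) * k y - ((UniqueFactorizationMonoid.radical y : ℕ) : ℤ) * k x)) ↔ (∀ p j a b : ℕ, p.Prime → 0 < a → 0 < b → ¬ p ∣ a → ¬ p ∣ b → ((p ^ (j + 1) : ℕ) : ℤ) ∣ (a : ℤ) + b ∨ ((p ^ (j + 1) : ℕ) : ℤ) ∣ (a : ℤ) - b → ((p ^ j : ℕ) : ℤ) ∣ ((UniqueFactorizationMonoid.radical a : ℕ) : ℤ) * k b - ((UniqueFactorizationMonoid.radical b : ℕ) : ℤ) * k a)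

-- earlier Assembly (stmt-ABC-11489, replaced 2026-08-15T23:38:13Z -> stmt-ABC-13990): retired by None — SmallCoherentNonConstant → SeparationUpgrade → Bridge → ABC
-- earlier Assembly (stmt-ABC-1695, replaced 2026-08-15T18:13:56Z -> stmt-ABC-11489): retired by None — SmallCoherentNonConstant → SeparationUpgrade → ABC
/-- item stmt-ABC-13990 · assembly · rank 1 · open · by planner
sources: Pasten2021
[assembly] RESTATED 2026-08-15 (ground repair; supersedes stmt-ABC-11489 = SmallCoherentNonConstant
→ SeparationUpgrade → Bridge → ABC, which is the curried type of `closes` itself, hence pure modus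
ponens — `tauto` closes it, ground.trivial). The assembly is now the statement that the two POSITIVE
CRUXES alone decide the summit: SmallCoherentNonConstant (rank 2: for every ε > 0 a coherent,
(ε,C)-small, non-constant k : ℕ → ℤ) → SeparationUpgrade (rank 4: that existence horn ⇒ the guarded
target SeparatingQuasiLogDerivativesR) → ABC, i.e. `closes` with the support Bridge DISCHARGED.
Proof = Bridge's five lines (coherence at (a,b): c ∣ rad c·D(a,b); separation: D(a,b) ≠ 0;
smallness: |D(a,b)| ≤ C·rad a·rad b·c^ε; hence c ≤ rad c·|D| ≤ C·rad(abc)·c^ε, c^(1−ε) ≤ C·rad(abc),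
and with ε = ε′/(1+ε′) this is ABC via `ABC_iff`; the excluded degenerate triple (1,1,2) is checked
directly) applied to hU hS — one line once Bridge (stmt-ABC-11488; sorry-free candidate proof
attached there by a refuter) has landed: `fun hS hU => bridge (hU hS)`. Same signature as the rev-1
assembly stmt-ABC-1695 (retired at the target repair, when the unguarded target made it vacuous),
now meaningful over the gu -/
@[route_item "route-ABC-GlobalQuasiLogDerivative"]
def Assembly : Prop :=
  SmallCoherentNonConstant → SeparationUpgrade → ABC

-- records of items no longer active in this route (dropped / restated):
-- earlier SeparatingQuasiLogDerivatives (stmt-ABC-1689, replaced 2026-08-15T18:13:56Z -> stmt-ABC-11486): refuted by Summit.ABC.ABC.Theorems.GlobalQuasiLogDerivativeSeparatingQuasiLogDerivatives_refuted — ∀ ε : ℝ, 0 < ε → ∃ C : ℝ, ∀ a b c : ℕ, Literature.NumberTheory.DiophantineGeometry.IsABCTriple a b c → ∃ k : ℕ → ℤ, (∀ x y : ℕ, 0 < x → 0 < y → Nat.Coprime x y → ((x + y : ℕ) : ℤ) ∣ ((UniqueFactori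

/-! D-0027 §2.1 — DECIDING THEOREM (planner-authored via `route open/edit --closes-file`; by planner-rfix-ABC-GlobalQuasiLogDerivative-371079c1-0 2026-08-15T18:13:56Z):
its hypotheses are this route's items and its conclusion the sub-problem Statement (glue_lint), and it elaborates with this file. -/

/-- D-0027 §2.1 deciding theorem of route GlobalQuasiLogDerivative (planner route-repair, 2026-08-15): the existence horn
SmallCoherentNonConstant (crux 2: for every ε > 0 a non-constant, coherent, (ε,C)-small k : ℕ → ℤ) is upgraded by
SeparationUpgrade (crux 4) to the repaired target SeparatingQuasiLogDerivativesR (every abc triple with a ≠ b is separated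
by such a k, C uniform), and Bridge (support: c ∣ rad c·D(a,b), D ≠ 0, |D| ≤ C·rad a·rad b·c^ε ⇒ c^(1−ε) ≤ C·rad(abc);
the excluded triple (1,1,2) checked directly) turns it into `ABC`. Rigidity (the staffed negation of crux 2) and LocalForm
(shared support) are deliberately not hypotheses. Pure modus ponens. -/
@[closes "route-ABC-GlobalQuasiLogDerivative"] theorem closes (hS : SmallCoherentNonConstant) (hU : SeparationUpgrade) (hB : Bridge) : _root_.ABC := hB (hU hS)

end Summit.ABC.ABC.Theses.GlobalQuasiLogDerivative
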